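import Literature.AlgebraicGeometry.HodgeTheory.BiextensionHeightPackage
import HarnessLib

/-!
# The Levi form of a `C²` function with the sub-mean-value property

Topic `Literature/Analysis/Pluripotential`. Pointwise ("smooth case") half of the positivity of
`dd^c g` for plurisubharmonic `g`, in the form needed by the Monge–Ampère densities of
`Literature.AlgebraicGeometry.HodgeTheory.BiextensionHeight.leviMatrix` / `heightDensity` and by
`NonPluripolarMongeAmpereMassProofs.lean` (step (P1) of the proof of
`BoucksomEtAl2010_regularMass_le_degree_pow`): a real function `g` on `ℂⁿ` that is `C²` at `w` and
satisfies the mean-value inequality over arbitrarily small circles of the complex line `w + ℂ v`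
has `D²g(w)(v, v) + D²g(w)(iv, iv) ≥ 0` (Hörmander, Thm. 1.6.3/§2.6: a `C²` function is
(pluri)subharmonic iff `Δu ≥ 0`, resp. its Levi form is `≥ 0` — here the easy direction, proved
from scratch), and a function whose Levi form is `≥ 0` in every direction and whose second
derivative is symmetric has a positive semidefinite `leviMatrix`.

## Main results

* `abs_taylor_two_sub_le` — uniform second-order Taylor bound at a `C²` point:
  `|g(w+h) - g(w) - Dg(w)h - ½D²g(w)(h,h)| ≤ ε‖h‖²` for `‖h‖ < δ` (two mean value inequalities
  applied to the remainder).
* `circleAverage_comp_mul_of_norm_eq_one` — rotation invariance of `Real.circleAverage` about `0`.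
* `levi_nonneg_of_frequently_le_circleAverage` — the statement above; proof by the symmetrisation
  `τ ↦ ±τ, ±iτ`, under which circle averages are invariant, first-order Taylor terms cancel and
  second-order terms add up to `|τ|² (D²g(w)(v,v) + D²g(w)(iv,iv))` (`bilin_smul_add_bilin_I_smul`),
  so a negative Levi form would force the circle averages below `g(w)`.
* `leviMatrix_apply`, `isHermitian_leviMatrix`, `re_star_dotProduct_leviMatrix_mulVec`,
  `posSemidef_leviMatrix` — the entries of `leviMatrix g w` through `B = D²g(w)`; Hermitian
  symmetry; `Re(x̄ᵀ A x) = ¼(B(x̄,x̄) + B(ix̄,ix̄))`; positive semidefiniteness.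

## References

* [HormanderSCV1973] L. Hörmander, An introduction to complex analysis in several variables,
  2nd ed. (1973): Thm. 1.6.3 (ii) and §2.6 (smooth case of (pluri)subharmonicity).
-/

noncomputable section

open scoped Topology ComplexConjugate ComplexOrder Matrix
open Filter Set Metric Complex
open Literature.AlgebraicGeometry.HodgeTheory.BiextensionHeight (leviMatrix)

namespace Literature.Analysis.Pluripotential

section Taylor

variable {E : Type*} [NormedAddCommGroup E] [NormedSpace ℝ E]

/-- **Second-order Taylor bound, uniform in the direction**: if `g` is `C²` at `w` then for every
`ε > 0` there is `δ > 0` with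
`|g(w + h) - g(w) - Dg(w) h - ½ D²g(w)(h, h)| ≤ ε ‖h‖²` for `‖h‖ < δ` (two applications of the
mean value inequality to the remainder, whose second derivative `D²g(x) - D²g(w)` is small near `w`).
[folklore] -/
theorem abs_taylor_two_sub_le (g : E → ℝ) (w : E) (hg : ContDiffAt ℝ 2 g w) {ε : ℝ} (hε : 0 < ε) :
    ∃ δ > 0, ∀ h : E, ‖h‖ < δ →
      |g (w + h) - g w - fderiv ℝ g w h - (fderiv ℝ (fderiv ℝ g) w h h) / 2| ≤ ε * ‖h‖ ^ 2 := by
  have hg' : ContDiffAt ℝ ((1 : ℕ) + 1) g w := by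
    rw [show ((1 : ℕ) : WithTop ℕ∞) + 1 = 2 by norm_num]; exact hg
  obtain ⟨f', ⟨u, hu, hf'⟩, hf'c⟩ := contDiffAt_succ_iff_hasFDerivAt.mp hg'
  have hf'c' : ContDiffAt ℝ ((0 : ℕ) + 1) f' w := by
    rw [show ((0 : ℕ) : WithTop ℕ∞) + 1 = 1 by norm_num]; exact hf'c
  obtain ⟨f'', ⟨u', hu', hf''⟩, hf''c⟩ := contDiffAt_succ_iff_hasFDerivAt.mp hf'c'
  -- identify the derivatives at `w`
  have hfd : fderiv ℝ g =ᶠ[𝓝 w] f' := by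
    filter_upwards [hu] with x hx using (hf' x hx).fderiv
  have hfd_w : fderiv ℝ g w = f' w := (hf' w (mem_of_mem_nhds hu)).fderiv
  have hfdd_w : fderiv ℝ (fderiv ℝ g) w = f'' w := by
    rw [hfd.fderiv_eq]; exact (hf'' w (mem_of_mem_nhds hu')).fderiv
  -- symmetry of the second derivative
  have hsymm : ∀ a b, f'' w a b = f'' w b a := by
    intro a b
    have := hg.isSymmSndFDerivAt (by simp) a b
    rwa [hfdd_w] at this
  -- continuity of `f''` at `w` and a good ball
  obtain ⟨δ₁, hδ₁, hδ₁'⟩ := Metric.continuousAt_iff.mp hf''c.continuousAt ε hε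
  obtain ⟨δ₂, hδ₂, hδ₂'⟩ := Metric.mem_nhds_iff.mp (inter_mem hu hu')
  obtain ⟨δ, hδ, hδδ₁, hδδ₂⟩ : ∃ δ > 0, δ ≤ δ₁ ∧ δ ≤ δ₂ :=
    ⟨min δ₁ δ₂, lt_min hδ₁ hδ₂, min_le_left _ _, min_le_right _ _⟩
  have hball_u : ball w δ ⊆ u := fun x hx ↦ (hδ₂' (ball_subset_ball hδδ₂ hx)).1
  have hball_u' : ball w δ ⊆ u' := fun x hx ↦ (hδ₂' (ball_subset_ball hδδ₂ hx)).2
  have hball_ε : ∀ x ∈ ball w δ, ‖f'' x - f'' w‖ ≤ ε := fun x hx ↦ by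
    rw [← dist_eq_norm]; exact (hδ₁' (ball_subset_ball hδδ₁ hx)).le
  set B := f'' w with hB
  -- the remainder and its derivative
  set R : E → ℝ := fun x ↦ g x - g w - f' w (x - w) - (B (x - w) (x - w)) / 2 with hR
  set R' : E → E →L[ℝ] ℝ := fun x ↦ f' x - f' w - B (x - w) with hR'
  have hBsub : ∀ y : E, HasFDerivAt (fun y ↦ B (y - w)) B y := fun y ↦ by
    have : (fun y ↦ B (y - w)) = fun y ↦ B y - B w := by funext y; rw [map_sub]
    rw [this]; exact B.hasFDerivAt.sub_const (B w)
  have hRderiv : ∀ x ∈ ball w δ, HasFDerivAt R (R' x) x := by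
    intro x hx
    have h1 : HasFDerivAt g (f' x) x := hf' x (hball_u hx)
    have h2 : HasFDerivAt (fun y ↦ f' w (y - w)) (f' w) x := by
      have : (fun y ↦ f' w (y - w)) = fun y ↦ f' w y - f' w w := by funext y; rw [map_sub]
      rw [this]; exact (f' w).hasFDerivAt.sub_const (f' w w)
    -- derivative of a symmetric quadratic form along the diagonal
    have hquad : ∀ B' : E →L[ℝ] E →L[ℝ] ℝ, (∀ a b, B' a b = B' b a) →
        HasFDerivAt (fun y ↦ B' (y - w) (y - w)) (B' (x - w) + B' (x - w)) x := by
      intro B' hB'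
      have hu₀ : HasFDerivAt (fun y : E ↦ y - w) (ContinuousLinearMap.id ℝ E) x :=
        (hasFDerivAt_id x).sub_const w
      have hB'sub : HasFDerivAt (fun y ↦ B' (y - w)) B' x := by
        have : (fun y ↦ B' (y - w)) = fun y ↦ B' y - B' w := by funext y; rw [map_sub]
        rw [this]; exact B'.hasFDerivAt.sub_const (B' w)
      have key := hB'sub.clm_apply hu₀
      have heq : (B' (x - w)).comp (ContinuousLinearMap.id ℝ E) + B'.flip (x - w) =
          B' (x - w) + B' (x - w) := by
        ext h
        simp only [add_apply, ContinuousLinearMap.comp_apply, ContinuousLinearMap.id_apply,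
          ContinuousLinearMap.flip_apply]
        rw [hB' h (x - w)]
      rwa [heq] at key
    have h4 : HasFDerivAt (fun y ↦ B (y - w) (y - w) / 2) (B (x - w)) x := by
      set B₂ : E →L[ℝ] E →L[ℝ] ℝ := (2⁻¹ : ℝ) • B with hB₂
      have hB₂app : ∀ a b, B₂ a b = B a b / 2 := fun a b ↦ by
        simp only [hB₂, smul_apply, smul_eq_mul]; ring
      have hB₂symm : ∀ a b, B₂ a b = B₂ b a := fun a b ↦ by rw [hB₂app, hB₂app, hsymm]
      have key := hquad B₂ hB₂symm
      have hfun : (fun y ↦ B (y - w) (y - w) / 2) = fun y ↦ B₂ (y - w) (y - w) := by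
        funext y; rw [hB₂app]
      have hder : B₂ (x - w) + B₂ (x - w) = B (x - w) := by
        ext h; simp only [add_apply, hB₂app]; ring
      rw [hfun, ← hder]; exact key
    have := ((h1.sub_const (g w)).sub h2).sub h4
    exact this
  have hR'w : R' w = 0 := by simp [hR']
  have hR'deriv : ∀ x ∈ ball w δ, HasFDerivAt R' (f'' x - B) x := by
    intro x hx
    have h1 : HasFDerivAt f' (f'' x) x := hf'' x (hball_u' hx)
    exact (h1.sub_const (f' w)).sub (hBsub x)
  -- first mean value inequality: `‖R' x‖ ≤ ε ‖x - w‖` on the ball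
  have hMVT1 : ∀ x ∈ ball w δ, ‖R' x‖ ≤ ε * ‖x - w‖ := by
    intro x hx
    have key := (convex_ball w δ).norm_image_sub_le_of_norm_hasFDerivWithin_le
      (f := R') (f' := fun y ↦ f'' y - B) (fun y hy ↦ (hR'deriv y hy).hasFDerivWithinAt) hball_ε
      (mem_ball_self hδ) hx
    rwa [hR'w, sub_zero] at key
  -- second mean value inequality on the closed ball of radius `‖h‖`
  refine ⟨δ, hδ, fun h hh ↦ ?_⟩
  have hsub : closedBall w ‖h‖ ⊆ ball w δ := closedBall_subset_ball hh
  have key := (convex_closedBall w ‖h‖).norm_image_sub_le_of_norm_hasFDerivWithin_le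
    (f := R) (f' := R') (C := ε * ‖h‖) (x := w) (y := w + h)
    (fun y hy ↦ (hRderiv y (hsub hy)).hasFDerivWithinAt)
    (fun y hy ↦ (hMVT1 y (hsub hy)).trans (by
      gcongr; rwa [mem_closedBall, dist_eq_norm] at hy))
    (mem_closedBall_self (norm_nonneg h)) (by simp [mem_closedBall, dist_eq_norm])
  have hRw : R w = 0 := by simp [hR]
  rw [hRw, sub_zero, add_sub_cancel_left, Real.norm_eq_abs] at key
  have hRh : R (w + h) = g (w + h) - g w - fderiv ℝ g w h - (fderiv ℝ (fderiv ℝ g) w h h) / 2 := by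
    simp only [hR, add_sub_cancel_left, hfd_w, hfdd_w]
  rw [hRh] at key
  calc _ ≤ ε * ‖h‖ * ‖h‖ := key
    _ = ε * ‖h‖ ^ 2 := by ring

end Taylor

section CircleRotation

variable {F : Type*} [NormedAddCommGroup F] [NormedSpace ℝ F]

/-- Circle averages about `0` are invariant under rotations `z ↦ u z`, `|u| = 1`. [folklore] -/
theorem circleAverage_comp_mul_of_norm_eq_one (f : ℂ → F) {u : ℂ} (hu : ‖u‖ = 1) (R : ℝ) :
    Real.circleAverage (fun z ↦ f (u * z)) 0 R = Real.circleAverage f 0 R := by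
  rw [Real.circleAverage_eq_integral_add (f := f) (arg u), Real.circleAverage_def]
  congr 1
  apply intervalIntegral.integral_congr
  intro θ _
  have hu' : u = exp (arg u * I) := by
    have := norm_mul_exp_arg_mul_I u
    rw [hu] at this
    simpa using this.symm
  simp only [circleMap, zero_add]
  congr 1
  rw [show ((θ + arg u : ℝ) : ℂ) * I = θ * I + arg u * I by push_cast; ring, Complex.exp_add]
  conv_lhs => rw [hu']
  ring

end CircleRotation

section Levi

variable {n : ℕ}

/-- `τ • v = (Re τ) v + (Im τ) (i v)` for `τ ∈ ℂ`, `v ∈ ℂⁿ`. [folklore] -/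
theorem smul_eq_re_smul_add_im_smul (τ : ℂ) (v : Fin n → ℂ) :
    τ • v = (τ.re : ℝ) • v + (τ.im : ℝ) • (I • v) := by
  conv_lhs => rw [← re_add_im τ]
  rw [add_smul, mul_smul, Complex.coe_smul, Complex.coe_smul]

/-- For a real bilinear form `B` on `ℂⁿ`: `B(τv, τv) + B(iτv, iτv) = |τ|² (B(v,v) + B(iv,iv))`
(the `τ`-rotation averages out the mixed terms). [folklore] -/
theorem bilin_smul_add_bilin_I_smul (B : (Fin n → ℂ) →L[ℝ] (Fin n → ℂ) →L[ℝ] ℝ) (τ : ℂ)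
    (v : Fin n → ℂ) :
    B (τ • v) (τ • v) + B ((I * τ) • v) ((I * τ) • v) =
      ‖τ‖ ^ 2 * (B v v + B (I • v) (I • v)) := by
  have h1 : τ • v = (τ.re : ℝ) • v + (τ.im : ℝ) • (I • v) := smul_eq_re_smul_add_im_smul τ v
  have h2 : (I * τ) • v = (τ.re : ℝ) • (I • v) + (-τ.im : ℝ) • v := by
    rw [mul_smul, h1, smul_add, smul_comm I (τ.re : ℝ) v, smul_comm I (τ.im : ℝ) (I • v),
      smul_smul, I_mul_I, neg_one_smul, smul_neg, ← neg_smul]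
  rw [h2, h1, Complex.sq_norm, Complex.normSq_apply]
  simp only [map_add, map_smul, add_apply, smul_apply, smul_eq_mul]
  ring

/-- **`C²` functions with the sub-mean-value property along a complex line have non-negative
Levi form in that direction**: if `g : ℂⁿ → ℝ` is `C²` at `w` and, for arbitrarily small `r > 0`,
`g(w) ≤ (2π)⁻¹ ∫₀^{2π} g(w + r e^{iθ} v) dθ`, then `D²g(w)(v, v) + D²g(w)(iv, iv) ≥ 0`
(`= 4 ∂∂̄`-derivative of `τ ↦ g(w + τ v)` at `0`). Proof: second-order Taylor expansion and the
symmetrisation `τ ↦ ±τ, ±iτ`, under which the circle average is invariant, the first-order terms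
cancel and the second-order terms add up to `|τ|² (D²g(w)(v,v) + D²g(w)(iv,iv))`.
[cite: HormanderSCV1973, Thm. 1.6.3 and §2.6 (smooth case)] -/
theorem levi_nonneg_of_frequently_le_circleAverage {g : (Fin n → ℂ) → ℝ} {w : Fin n → ℂ}
    (hg : ContDiffAt ℝ 2 g w) (v : Fin n → ℂ)
    (hsub : ∃ᶠ r in 𝓝[>] (0 : ℝ), g w ≤ Real.circleAverage (fun τ : ℂ ↦ g (w + τ • v)) 0 r) :
    0 ≤ fderiv ℝ (fderiv ℝ g) w v v + fderiv ℝ (fderiv ℝ g) w (I • v) (I • v) := by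
  set B := fderiv ℝ (fderiv ℝ g) w with hB
  set L := B v v + B (I • v) (I • v) with hL
  by_contra hneg
  push Not at hneg
  -- continuity of `g` near `w`
  have hg' : ContDiffAt ℝ ((1 : ℕ) + 1) g w := by
    rw [show ((1 : ℕ) : WithTop ℕ∞) + 1 = 2 by norm_num]; exact hg
  obtain ⟨f', ⟨U, hU, hf'⟩, -⟩ := contDiffAt_succ_iff_hasFDerivAt.mp hg'
  have hcont : ContinuousOn g U := fun x hx ↦ (hf' x hx).continuousAt.continuousWithinAt
  -- Taylor with a small `ε`
  set ε := -L / (8 * (‖v‖ ^ 2 + 1)) with hε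
  have hεpos : 0 < ε := div_pos (neg_pos.2 hneg) (by positivity)
  have hεL : L / 4 + ε * ‖v‖ ^ 2 < 0 := by
    have h1 : ε * ‖v‖ ^ 2 ≤ -L / 8 := by
      rw [hε, div_mul_eq_mul_div, div_le_div_iff₀ (by positivity) (by norm_num)]
      nlinarith [sq_nonneg ‖v‖]
    linarith
  obtain ⟨δ₁, hδ₁, hT⟩ := abs_taylor_two_sub_le g w hg hεpos
  obtain ⟨δ₂, hδ₂, hδ₂U⟩ := Metric.mem_nhds_iff.mp hU
  -- small radii
  have hsmall : ∀ᶠ r in 𝓝[>] (0 : ℝ), 0 < r ∧ r * (‖v‖ + 1) < min δ₁ δ₂ := by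
    have h0 : (0 : ℝ) < min δ₁ δ₂ / (‖v‖ + 1) := div_pos (lt_min hδ₁ hδ₂) (by positivity)
    filter_upwards [Ioo_mem_nhdsGT h0] with r hr
    exact ⟨hr.1, (lt_div_iff₀ (by positivity)).1 hr.2⟩
  -- the circle averages are eventually `< g w`, contradicting the hypothesis
  have hlt : ∀ᶠ r in 𝓝[>] (0 : ℝ), Real.circleAverage (fun τ : ℂ ↦ g (w + τ • v)) 0 r < g w := by
    filter_upwards [hsmall] with r ⟨hr, hrδ⟩
    have hrδ₁ : r * ‖v‖ < δ₁ := by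
      have := min_le_left δ₁ δ₂; nlinarith [norm_nonneg v]
    have hrδ₂ : r * ‖v‖ < δ₂ := by
      have := min_le_right δ₁ δ₂; nlinarith [norm_nonneg v]
    -- the four rotated functions
    set φ : ℂ → ℂ → ℝ := fun u τ ↦ g (w + (u * τ) • v) with hφ
    have hnorm : ∀ (u τ : ℂ), ‖u‖ = 1 → τ ∈ sphere (0 : ℂ) |r| → ‖(u * τ) • v‖ = r * ‖v‖ := by
      intro u τ hu hτ
      rw [mem_sphere_zero_iff_norm, abs_of_pos hr] at hτ
      rw [norm_smul, norm_mul, hu, hτ, one_mul]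
    have hint : ∀ u : ℂ, ‖u‖ = 1 → CircleIntegrable (φ u) 0 r := by
      intro u hu
      apply ContinuousOn.circleIntegrable'
      have hmaps : MapsTo (fun τ : ℂ ↦ w + (u * τ) • v) (sphere (0 : ℂ) |r|) U := by
        intro τ hτ
        apply hδ₂U
        rw [mem_ball, dist_eq_norm, add_sub_cancel_left, hnorm u τ hu hτ]
        exact hrδ₂
      exact hcont.comp (by fun_prop) hmaps
    have havg : ∀ u : ℂ, ‖u‖ = 1 →
        Real.circleAverage (φ u) 0 r = Real.circleAverage (fun τ : ℂ ↦ g (w + τ • v)) 0 r := by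
      intro u hu
      exact circleAverage_comp_mul_of_norm_eq_one (fun τ : ℂ ↦ g (w + τ • v)) hu r
    -- pointwise bound for the symmetrised function on the circle
    have hpt : ∀ τ ∈ sphere (0 : ℂ) |r|,
        (φ 1 + φ (-1) + φ I + φ (-I)) τ ≤ 4 * g w + r ^ 2 * L + 4 * (ε * (r * ‖v‖) ^ 2) := by
      intro τ hτ
      have hτr : ‖τ‖ = r := by rwa [mem_sphere_zero_iff_norm, abs_of_pos hr] at hτ
      have key : ∀ u : ℂ, ‖u‖ = 1 → g (w + (u * τ) • v) ≤ g w + fderiv ℝ g w ((u * τ) • v)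
          + B ((u * τ) • v) ((u * τ) • v) / 2 + ε * (r * ‖v‖) ^ 2 := by
        intro u hu
        have h := hT ((u * τ) • v) (by rw [hnorm u τ hu hτ]; exact hrδ₁)
        rw [hnorm u τ hu hτ] at h
        have := (abs_le.1 h).2
        linarith
      have k1 := key 1 (by simp)
      have k2 := key (-1) (by simp)
      have k3 := key I (by simp)
      have k4 := key (-I) (by simp)
      have e1 : ((1 : ℂ) * τ) • v = τ • v := by rw [one_mul]
      have e2 : ((-1 : ℂ) * τ) • v = -(τ • v) := by rw [neg_mul, one_mul, neg_smul]
      have e4 : (-I * τ) • v = -((I * τ) • v) := by rw [neg_mul, neg_smul]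
      rw [e1] at k1
      rw [e2] at k2
      rw [e4] at k4
      simp only [map_neg, neg_apply, neg_neg] at k2 k4
      have hquad := bilin_smul_add_bilin_I_smul B τ v
      rw [hτr, ← hL] at hquad
      show g (w + ((1 : ℂ) * τ) • v) + g (w + ((-1 : ℂ) * τ) • v) + g (w + (I * τ) • v)
        + g (w + (-I * τ) • v) ≤ _
      rw [e1, e2, e4]
      linarith [hquad, k1, k2, k3, k4]
    -- assemble
    have hsum : Real.circleAverage (φ 1 + φ (-1) + φ I + φ (-I)) 0 r =
        4 * Real.circleAverage (fun τ : ℂ ↦ g (w + τ • v)) 0 r := by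
      have i1 := hint 1 (by simp)
      have i2 := hint (-1) (by simp)
      have i3 := hint I (by simp)
      have i4 := hint (-I) (by simp)
      rw [Real.circleAverage_add ((i1.add i2).add i3) i4, Real.circleAverage_add (i1.add i2) i3,
        Real.circleAverage_add i1 i2, havg 1 (by simp), havg (-1) (by simp), havg I (by simp),
        havg (-I) (by simp)]
      ring
    have hle : Real.circleAverage (φ 1 + φ (-1) + φ I + φ (-I)) 0 r ≤
        4 * g w + r ^ 2 * L + 4 * (ε * (r * ‖v‖) ^ 2) :=
      Real.circleAverage_mono_on_of_le_circle
        ((((hint 1 (by simp)).add (hint (-1) (by simp))).add (hint I (by simp))).add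
          (hint (-I) (by simp))) hpt
    rw [hsum] at hle
    have hr2 : 0 < r ^ 2 := by positivity
    nlinarith [hle, hεL, hr2, mul_neg_of_pos_of_neg hr2 hεL]
  obtain ⟨r, hle, hlt'⟩ := (hsub.and_eventually hlt).exists
  exact absurd hle (not_le.mpr hlt')

end Levi

section LeviMatrixPSD

variable {n : ℕ}

/-- The entries of `leviMatrix g w` in terms of the second Fréchet derivative
`B = D(Dg)(w)`: `A_{pq} = ¼(B(e_p,e_q) + B(ie_p,ie_q)) + ¼ i (B(e_p,ie_q) - B(ie_p,e_q))`. [folklore] -/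
theorem leviMatrix_apply (g : (Fin n → ℂ) → ℝ) (w : Fin n → ℂ) (p q : Fin n) :
    leviMatrix g w p q =
      ((((fderiv ℝ (fderiv ℝ g) w (Pi.single p 1) (Pi.single q 1)
          + fderiv ℝ (fderiv ℝ g) w (I • Pi.single p 1) (I • Pi.single q 1) : ℝ) : ℂ))
        + ((fderiv ℝ (fderiv ℝ g) w (Pi.single p 1) (I • Pi.single q 1)
          - fderiv ℝ (fderiv ℝ g) w (I • Pi.single p 1) (Pi.single q 1) : ℝ) : ℂ) * I) / 4 := by
  simp only [leviMatrix, iteratedFDeriv_two_apply, Matrix.cons_val_zero, Matrix.cons_val_one]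

/-- The Levi matrix of a function with symmetric second derivative is Hermitian. [folklore] -/
theorem isHermitian_leviMatrix {g : (Fin n → ℂ) → ℝ} {w : Fin n → ℂ}
    (hsymm : ∀ a b, fderiv ℝ (fderiv ℝ g) w a b = fderiv ℝ (fderiv ℝ g) w b a) :
    (leviMatrix g w).IsHermitian := by
  apply Matrix.IsHermitian.ext
  intro p q
  rw [leviMatrix_apply, leviMatrix_apply]
  apply Complex.ext
  · simp
    linarith [hsymm (Pi.single p 1) (Pi.single q 1),
      hsymm (I • Pi.single p 1) (I • Pi.single q 1)]
  · simp
    linarith [hsymm (Pi.single p 1) (I • Pi.single q 1),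
      hsymm (I • Pi.single p 1) (Pi.single q 1)]

/-- Expansion of a real bilinear form on complex multiples of two vectors. [folklore] -/
theorem bilin_smul_smul_add (B : (Fin n → ℂ) →L[ℝ] (Fin n → ℂ) →L[ℝ] ℝ) (c d : ℂ)
    (e f : Fin n → ℂ) :
    B (c • e) (d • f) + B (I • (c • e)) (I • (d • f)) =
      (c.re * d.re + c.im * d.im) * (B e f + B (I • e) (I • f))
        + (c.re * d.im - c.im * d.re) * (B e (I • f) - B (I • e) f) := by
  have hI : ∀ (a : ℂ) (u : Fin n → ℂ), I • (a • u) = (a.re : ℝ) • (I • u) + (-a.im : ℝ) • u := by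
    intro a u
    rw [smul_eq_re_smul_add_im_smul a u, smul_add, smul_comm I (a.re : ℝ) u,
      smul_comm I (a.im : ℝ) (I • u), smul_smul, I_mul_I, neg_one_smul, smul_neg, ← neg_smul]
  rw [hI c e, hI d f, smul_eq_re_smul_add_im_smul c e, smul_eq_re_smul_add_im_smul d f]
  simp only [map_add, map_smul, add_apply, smul_apply, smul_eq_mul]
  ring

/-- A scalar identity: `Re(c d̄ (α + iβ)/4) = ((Re c Re d + Im c Im d) α + (Re c Im d - Im c Re d) β)/4`.
[folklore] -/
theorem re_mul_conj_mul_div_four (c d : ℂ) (α β : ℝ) :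
    (c * ((((α : ℝ) : ℂ) + ((β : ℝ) : ℂ) * I) / 4 * conj d)).re =
      ((c.re * d.re + c.im * d.im) * α + (c.re * d.im - c.im * d.re) * β) / 4 := by
  simp [Complex.mul_re, Complex.mul_im]
  ring

/-- A vector of `ℂⁿ` as a combination of the standard basis vectors. [folklore] -/
theorem eq_sum_smul_single (y : Fin n → ℂ) :
    y = ∑ p, y p • (Pi.single p (1 : ℂ) : Fin n → ℂ) := by
  ext j
  simp [Finset.sum_apply, Pi.single_apply]

/-- **The Hermitian form of the Levi matrix is the Levi form**: for `x ∈ ℂⁿ`,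
`Re (x̄ᵀ A x) = ¼ (B(x̄, x̄) + B(i x̄, i x̄))`, `A = leviMatrix g w`, `B = D²g(w)`, `x̄ = star x`.
[folklore] -/
theorem re_star_dotProduct_leviMatrix_mulVec (g : (Fin n → ℂ) → ℝ) (w x : Fin n → ℂ) :
    (star x ⬝ᵥ (leviMatrix g w *ᵥ x)).re =
      (fderiv ℝ (fderiv ℝ g) w (star x) (star x)
        + fderiv ℝ (fderiv ℝ g) w (I • star x) (I • star x)) / 4 := by
  set B := fderiv ℝ (fderiv ℝ g) w with hB
  set y := star x with hy
  have hx : x = star y := by rw [hy, star_star]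
  set e : Fin n → (Fin n → ℂ) := fun p ↦ Pi.single p 1 with he
  -- the left-hand side as a double sum
  have lhs : star x ⬝ᵥ (leviMatrix g w *ᵥ x) =
      ∑ p, ∑ q, y p * (leviMatrix g w p q * conj (y q)) := by
    rw [hx, star_star]
    simp only [dotProduct, Matrix.mulVec, Finset.mul_sum, Pi.star_apply, Complex.star_def]
  -- the right-hand side as a double sum
  have hyy : y = ∑ p, y p • e p := eq_sum_smul_single y
  have rhs : B y y + B (I • y) (I • y) =
      ∑ p, ∑ q, (B (y p • e p) (y q • e q) + B (I • (y p • e p)) (I • (y q • e q))) := by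
    have h1 : B y y = ∑ p, ∑ q, B (y p • e p) (y q • e q) := by
      conv_lhs => rw [hyy]
      simp only [map_sum, FunLike.coe_sum, Finset.sum_apply]
      exact Finset.sum_comm
    have h2 : B (I • y) (I • y) = ∑ p, ∑ q, B (I • (y p • e p)) (I • (y q • e q)) := by
      conv_lhs => rw [hyy]
      simp only [Finset.smul_sum, map_sum, FunLike.coe_sum, Finset.sum_apply]
      exact Finset.sum_comm
    rw [h1, h2, ← Finset.sum_add_distrib]
    refine Finset.sum_congr rfl fun p _ ↦ ?_
    rw [← Finset.sum_add_distrib]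
  rw [lhs, rhs, Complex.re_sum, Finset.sum_div]
  refine Finset.sum_congr rfl fun p _ ↦ ?_
  rw [Complex.re_sum, Finset.sum_div]
  refine Finset.sum_congr rfl fun q _ ↦ ?_
  rw [bilin_smul_smul_add, leviMatrix_apply, re_mul_conj_mul_div_four]

/-- **Positive semidefiniteness of the Levi matrix from non-negativity of the Levi form**: if the
second derivative of `g` at `w` is symmetric and `D²g(w)(v,v) + D²g(w)(iv,iv) ≥ 0` for all `v`,
then `leviMatrix g w` is positive semidefinite. [folklore] -/
theorem posSemidef_leviMatrix {g : (Fin n → ℂ) → ℝ} {w : Fin n → ℂ}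
    (hsymm : ∀ a b, fderiv ℝ (fderiv ℝ g) w a b = fderiv ℝ (fderiv ℝ g) w b a)
    (hpos : ∀ v, 0 ≤ fderiv ℝ (fderiv ℝ g) w v v + fderiv ℝ (fderiv ℝ g) w (I • v) (I • v)) :
    (leviMatrix g w).PosSemidef := by
  have hH := isHermitian_leviMatrix hsymm
  refine Matrix.PosSemidef.of_dotProduct_mulVec_nonneg hH fun x ↦ ?_
  rw [Complex.nonneg_iff]
  constructor
  · rw [re_star_dotProduct_leviMatrix_mulVec]
    exact div_nonneg (hpos (star x)) (by norm_num)
  · have := hH.im_star_dotProduct_mulVec_self x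
    simpa using this.symm

end LeviMatrixPSD

end Literature.Analysis.Pluripotential

end
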